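import Summits.Parity.GeneralizedHardyLittlewood.Theorems.LiouvilleShiftedTablesDefs
import Summits.Parity.GeneralizedHardyLittlewood.Theorems.LiouvilleShiftedTablesBVLiouville
import Summits.Parity.GeneralizedHardyLittlewood.Theorems.LiouvilleShiftedTablesTypeI2DilatedWindow
import Summits.Parity.GeneralizedHardyLittlewood.Theorems.LiouvilleShiftedTablesTypeI2DilatedPeel6
import Summits.Parity.GeneralizedHardyLittlewood.Theorems.LiouvilleShiftedTablesTypeI2DilatedStubMainTerms
import Summits.Parity.GeneralizedHardyLittlewood.Theorems.LiouvilleShiftedTablesTypeI2DilatedURBound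
import Summits.Parity.GeneralizedHardyLittlewood.Theorems.LiouvilleShiftedTablesTypeI2DilatedAssemble6

/-!
# Line `peel-to-drappeau` — skeleton v9 for the crux `TypeI2Dilated` (stmt-Parity-14272)

Route `LiouvilleShiftedTables` (Parity / GeneralizedHardyLittlewood), crux decl
`Summit.Parity.GeneralizedHardyLittlewood.Theses.LiouvilleShiftedTables.TypeI2Dilated` (rank 4): for `c ≠ 0`
there is `ρ > 0` with `∑_{q ≤ x^ρ} ∑_{r ≤ R} |∑_{s ≤ S} ∑_{n ≤ y/(sr), rsn ≡ w (q)} λ(rsn + c)| ≤ C x/(log x)^A`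
for `R ≤ x^ρ`, `S R ≤ x^{1/2+ρ}`, `y ≤ x`.

Idea (card `Ideas/peel-to-drappeau.md`, line card `Lines/peel-to-drappeau.md`): peel both rough moduli (`r`
and the dilation `q`) onto the sequence side so that the dispersion only sees the smooth modulus `s ⊥ qrc`;
there Drappeau 2017 Thm 5.1 (hypothesis-free, power-saving `𝔲_R`-dispersion) is the Type-II engine; the
subtracted small-conductor characters come back as a double-family Bombieri–Vinogradov mean value for `λ`.

## Stubs (registered on stmt-Parity-14272 by the lead; v3 reshaping of the planner's six; v4: `DilatedMainTerms` carries the smooth-part index `P` after the assembly audit)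

* `stub_facts : LineFacts` — `DrappeauTypeII ∧ DilatedDivisorAP`, abbreviations of the Literature named facts
  `Drappeau2017_theorem51` (p72040) and `FouvryTenenbaum2021_lemma412 ∧ …_lemma413` (p72050): deep published
  theorems; the crux closes MODULO them (conditional-result) — this stub is discharged only by proofs of the facts.
* `stub_bvLiouville : BVLiouville` — the route's support item stmt-Parity-13324 (BV for `λ`), from the tree's
  PROVED `bombieriVinogradov_moebius` (per-modulus heights) via `λ = 𝟙_□ ⋆ μ`.
* `stub_peel : PeelStep := DrappeauTypeII → DilatedTypeIICore` — THE PEEL, purely arithmetic (v3: the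
  hyperbolic window moved out into `stub_window`).
* `stub_window : WindowStep := DilatedTypeIICore → DilatedTypeII` — separation of the window `Ylo < mn ≤ Yhi`
  at logarithmic cost by a finite Fourier series in `log(mn)` (transition width `x^{−3ρ₀}`, strips trivially).
* `stub_mainTerms : MainTermsStep := BVLiouville → DilatedMainTerms` — the double-family BV for `λ` (lead's stub).
* `stub_uRBound : URBound` — the `𝔲_R` terms of the assembly (Heath-Brown for `μ` + trichotomy; v6, wave 2).
* `stub_assembleFrom : AssembleFrom := URBound → AssembleStep` — the assembly minus its heart (PROVED by w-assemble
  modulo the v6 refactor and landing).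
* `TypeI2Dilated_of : TypeI2Dilated` — kernel-checked composition, concluding the crux BY NAME.

Vocabulary: the line's Defs file `Theorems/LiouvilleShiftedTablesDefs.lean` (p74294) is imported.  Status
2026-08-16T09:00Z (v9): ALL SIX PROOF STUBS LANDED — `stub_bvLiouville` (p74740), `stub_window` (p77777),
`stub_peel` (p90047, chain Peel1–6), `stub_mainTerms` (p88506, chain MainTerms1–8), `stub_uRBound` (p92572, chain URB1–11 +
nine Literature files), `stub_assembleFrom` (p89827, chain Assemble1–6).  The only `sorry` left is `stub_facts : LineFacts`, the
conjunction of the Literature NAMED FACTS `Drappeau2017_theorem51` and `FouvryTenenbaum2021_lemma412 ∧ FouvryTenenbaum2021_lemma413`: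
the crux is CLOSED MODULO these published theorems (the sorry-free conditional form `TypeI2Dilated_of_lineFacts` is landed
separately as `Theorems/LiouvilleShiftedTablesTypeI2DilatedOfFacts.lean`).

Disproof constraints honoured (cdisprove gen-2; Negative/* landed): Siegel–Walfisz strength enters through
`stub_bvLiouville` (used by `stub_mainTerms` below `(log x)^B` and by `stub_assemble` in the BV range) — where the
periodic / `χ₄` / biased-class ghosts die; `y ≤ x` is used in `stub_assemble` (`Y = y + c ≤ 2x`); `∀ A ∃ C`
kept everywhere; every intermediate statement is monotone in `ρ` (`∃ ρ₀ ∀ ρ ≤ ρ₀`).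
-/

noncomputable section

namespace Summit.Parity.GeneralizedHardyLittlewood.Cruxes.TypeI2Dilated.PeelToDrappeau

open Finset Real
open scoped ArithmeticFunction.sigma Classical
open Literature.NumberTheory.Sieve Literature.NumberTheory.Sieve.Drappeau2017
  Literature.NumberTheory.Sieve.FouvryTenenbaum2021
open Summit.Parity.GeneralizedHardyLittlewood.Theses.LiouvilleShiftedTables (TypeI2Dilated BVLiouville)

/-! ### Registered stubs (v9): only the named facts remain; `stub_bvLiouville`, `stub_window`, `stub_peel`, `stub_mainTerms`, `stub_uRBound`, `stub_assembleFrom` are the LANDED theorems of `…BVLiouville.lean`, `…TypeI2DilatedWindow.lean`, `…TypeI2DilatedPeel6.lean`, `…TypeI2DilatedStubMainTerms.lean`, `…TypeI2DilatedURBound.lean`, `…TypeI2DilatedAssemble6.lean` (imported) -/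

/-- STUB (named facts): `LineFacts = DrappeauTypeII ∧ DilatedDivisorAP` — Drappeau 2017 Thm 5.1 and
Fouvry–Tenenbaum 2021 Lemmas 4.12–4.13, the Literature named facts `Drappeau2017_theorem51` (p72040) and
`FouvryTenenbaum2021_lemma412 ∧ FouvryTenenbaum2021_lemma413` (p72050).  Deep published theorems (Kuznetsov with
congruence conditions; Weil; Deligne): discharged only by proofs of the facts; until then the crux closes modulo
them (conditional-result). [cite: Drappeau2017, Thm 5.1; FouvryTenenbaum2021, Lemmas 4.12–4.13] -/
theorem stub_facts : LineFacts := by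
  sorry

/-! ### Composition (kernel-checked; `sorry` enters only through the open `stub_*`) -/

/-- THE SKELETON: the seven registered stubs compose to the crux
`Summit.Parity.GeneralizedHardyLittlewood.Theses.LiouvilleShiftedTables.TypeI2Dilated` BY NAME —
`assembleFrom uRBound (window (peel facts.1)) (mainTerms bv) facts.2 bv`.  No `sorry` of its own; closed exactly
when the seven stubs are. [this line] -/
theorem TypeI2Dilated_of :
    Summit.Parity.GeneralizedHardyLittlewood.Theses.LiouvilleShiftedTables.TypeI2Dilated :=
  (show DilatedTypeII → DilatedMainTerms → DilatedDivisorAP →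
      Summit.Parity.GeneralizedHardyLittlewood.Theses.LiouvilleShiftedTables.BVLiouville →
      Summit.Parity.GeneralizedHardyLittlewood.Theses.LiouvilleShiftedTables.TypeI2Dilated
      from (show URBound → AssembleStep from stub_assembleFrom) stub_uRBound)
    ((show DilatedTypeIICore → DilatedTypeII from stub_window)
      ((show DrappeauTypeII → DilatedTypeIICore from stub_peel) stub_facts.1))
    ((show Summit.Parity.GeneralizedHardyLittlewood.Theses.LiouvilleShiftedTables.BVLiouville →
        DilatedMainTerms from stub_mainTerms) stub_bvLiouville)
    stub_facts.2 stub_bvLiouville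

/-- The hypothetical form of the composition — pure logic in the seven stub STATEMENTS (an `example`, so that
`TypeI2Dilated_of` stays the unique declaration concluding the crux). -/
example :
    LineFacts → Summit.Parity.GeneralizedHardyLittlewood.Theses.LiouvilleShiftedTables.BVLiouville →
    PeelStep → WindowStep → MainTermsStep → URBound → AssembleFrom →
    Summit.Parity.GeneralizedHardyLittlewood.Theses.LiouvilleShiftedTables.TypeI2Dilated :=
  fun hF hBV hPeel hWin hMain hU hAsm =>
    (show DilatedTypeII → DilatedMainTerms → DilatedDivisorAP →
        Summit.Parity.GeneralizedHardyLittlewood.Theses.LiouvilleShiftedTables.BVLiouville →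
        Summit.Parity.GeneralizedHardyLittlewood.Theses.LiouvilleShiftedTables.TypeI2Dilated
        from (show URBound → AssembleStep from hAsm) hU)
      ((show DilatedTypeIICore → DilatedTypeII from hWin)
        ((show DrappeauTypeII → DilatedTypeIICore from hPeel) hF.1))
      ((show Summit.Parity.GeneralizedHardyLittlewood.Theses.LiouvilleShiftedTables.BVLiouville →
          DilatedMainTerms from hMain) hBV)
      hF.2 hBV

-- audit: the conclusion is the route decl itself
#check (TypeI2Dilated_of : TypeI2Dilated)

end Summit.Parity.GeneralizedHardyLittlewood.Cruxes.TypeI2Dilated.PeelToDrappeau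

end
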